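import Summits.Ventures.LatticeQCDFlow.Scoring.NonabelianAreaLaw2DWilsonLoop
import Summits.Ventures.LatticeQCDFlow.Scoring.OnePlaquetteMatrixSchur
import HarnessLib

/-!
# The exact non-abelian area law in two dimensions, III: the free-boundary Wilson loop `⟨W_{R×T}⟩ = (M/∫w)^{RT}`; for `U(N)` and `SU(N)`, `⟨W_{R×T}⟩_β = P_N(β)^{RT}`

HONEST FRAMING: exact (Metropolis-corrected) sampling algorithms for lattice gauge theory;
figures of merit are autocorrelation/cost numbers at stated couplings and volumes; no
continuum-physics claim.

Venture `LatticeQCDFlow` (cell pub-lqcd), sub-topic `Scoring`; FANOUT row 5 (`s0-sun-a`), GEN-18.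
NEW WORK of the cell (placement rule); closes the lead's NOT-TYPED item "general-`N` free-boundary area law
for `N ≥ 3`" — for EVERY `N`, both `U(N)` and `SU(N)`, every real `β`, with no characters, Peter–Weyl or gauge
fixing.  Inputs: part II's matrix area law `∫ ρ(W_{R×T})_{ab} ∏_p w(U_p) dHaar^{⊗E} = (M^{RT})_{ab}`
(`NonabelianAreaLaw2DWilsonLoop`, every compact `G`, continuous `ρ`, continuous class weight `w`,
`M = ∫ ρ(g) w(g) dg`) and `OnePlaquetteMatrixSchur` (`M` is the real scalar `N⁻¹∫ Re tr g · w(g) dg` for the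
defining representations of `U(N)`, `SU(N)` and any weight `F(Re tr g)`).

Setting: the open `R × T` lattice realised in the torus `(ℤ/L)²` (`R + 1 ≤ L`, `T + 1 ≤ L`): weights
`∏_{p∈B} w(U_p)` on the plaquettes `B = {(i+a, j+b)}` enclosed by the loop `W = rectangleHolonomy U (i,j) 0 1 R T`,
all links Haar; `⟨X⟩_{B,w} := ∫ X ∏_p w(U_p) dHaar^{⊗E} / ∫ ∏_p w(U_p) dHaar^{⊗E}`.

* §5 (every compact `G`) **`integral_prod_weight_rect`** — the free-boundary partition function FACTORISES,
  `∫ ∏_{p∈B} w(U_p) = (∫ w)^{RT}` (the matrix law for `ρ = 1`, `N = 1`; `pow_apply_fin_one`);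
  **`integral_rep_rectangleHolonomy_div_eq`** — `⟨ρ(W)_{ab}⟩_{B,w} = ((M/∫w)^{RT})_{ab}`;
  **`integral_wilsonLoop_mul_prod_weight_of_scalar`**, **`openWilsonLoop_eq_re_pow_of_scalar`** — if
  `M = c·1` then the tree's `wilsonLoop ρ = N⁻¹ Re tr ρ(W)` obeys `⟨W_{R×T}⟩_{B,w} = Re((c/∫w)^{RT})`;
* §6 **`unitary_openWilsonLoop_eq_plaquette_pow`**, **`specialUnitary_openWilsonLoop_eq_plaquette_pow`** —
  THE EXACT AREA LAW for `U(N)` and `SU(N)`, every `N ≥ 1`, every real `β`, theory-2's conventions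
  (`wilsonLoop`, weight `e^{−β(N − Re tr U_p)}`): `⟨W_{R×T}⟩_{B,β} = P_N(β)^{RT}` with the one-plaquette
  plaquette `P_N(β) = ∫ (Re tr u/N) e^{−β(N−Re tr u)} du / ∫ e^{−β(N−Re tr u)} du` — string tension
  `−log P_N(β)` exactly, no perimeter term, no dependence on `L` or on the position; GEN-17 gives `P_N` in
  closed Bessel form (`U(N)`: `N⁻¹(log det[I_{|i−j|}])′`, `OnePlaquetteHaarMGF`; `SU(N)`:
  `SUNOnePlaquettePlaquetteBessel`; `SU(2)`: `I₂(2β)/I₁(2β)` = GEN-12's character-expansion result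
  `SU2OpenRectangleWilsonLoops`; `SU(3)`: the S0-C oracle); and the free-boundary PARTITION FUNCTIONS in
  closed form: **`unitary_open_partitionFunction_eq`** `= (e^{−Nβ} det[I_{|i−j|}(β)])^{RT}`,
  **`specialUnitary_open_partitionFunction_eq`** `= (e^{−Nβ} Σ_q det[I_{|q+i−j|}(β)])^{RT}`.

Published forms: Gross–Witten, Phys. Rev. D 21 (1980) 446 §II (`U(N)`: `w(R×T) = w^{RT}`); Bars–Green, Phys.
Rev. D 20 (1979) 3311; Balian–Drouffe–Itzykson 1975; Migdal 1975.  NOT here: a loop strictly inside a LARGER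
open lattice (its outer plaquettes peel off by part I §1 without changing the value — sequel), the torus
(finite-size corrections `O(r^{L²−RT})`, cf. GEN-11 for `SU(2)`).  No `def`, nothing cited as a fact, 0 sorry.
-/

noncomputable section

open MeasureTheory Function Finset
open Literature.MathematicalPhysics.QuantumFieldTheory
open Literature.MathematicalPhysics.QuantumLattice
open Literature.Analysis.FunctionSpaces (besselI)
open Summit.Ventures.LatticeQCDFlow.Theory2.Lattice
open Summit.Ventures.LatticeQCDFlow.Theory2.Lattice.TwoDim

namespace Summit.Ventures.LatticeQCDFlow.Scoring

variable {L : ℕ} [NeZero L]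

section AnyGroup

variable {G : Type*} [Group G] [TopologicalSpace G] [IsTopologicalGroup G]
  [CompactSpace G] [SecondCountableTopology G] [MeasurableSpace G] [BorelSpace G]

/-! ## §5. Consequences: the free-boundary partition function factorises; the normalised laws -/

section Consequences

omit [NeZero L] [Group G] [TopologicalSpace G] [IsTopologicalGroup G] [CompactSpace G]
  [SecondCountableTopology G] [MeasurableSpace G] [BorelSpace G] in
/-- Powers of a `1 × 1` matrix act on its single entry. -/
theorem pow_apply_fin_one (M : Matrix (Fin 1) (Fin 1) ℂ) (n : ℕ) : (M ^ n) 0 0 = (M 0 0) ^ n := by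
  have hM : M = M 0 0 • (1 : Matrix (Fin 1) (Fin 1) ℂ) := by
    ext k l
    fin_cases k; fin_cases l
    simp
  conv_lhs => rw [hM]
  rw [smul_pow, one_pow, Matrix.smul_apply, Matrix.one_apply_eq, smul_eq_mul, mul_one]

/-- **THE FREE-BOUNDARY PARTITION FUNCTION FACTORISES** (every compact gauge group, every continuous
class-function weight): for the `R × T` rectangle `B` with corner `(i, j)` (`R + 1 ≤ L`, `T + 1 ≤ L`),
`∫ ∏_{p ∈ B} w(U_p) dHaar^{⊗E} = (∫ w dHaar)^{RT}` — the case `N = 1`, `ρ = 1` of the matrix area law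
(the Wilson loop of the trivial representation).  Cf. row 30's puncture theorem
`PlaquetteIndependence2D.lintegral_prod_plaquette_eq` (Lebesgue form, any finite set off a puncture). -/
theorem integral_prod_weight_rect {w : G → ℝ} (hw : Continuous w) (hwc : ∀ k g, w (k * g * k⁻¹) = w g)
    (i j : ZMod L) {R T : ℕ} (hR : R + 1 ≤ L) (hT : T + 1 ≤ L) :
    ∫ U, ∏ p ∈ (range R ×ˢ range T).image (fun q : ℕ × ℕ => (![i + q.1, j + q.2] : Site 2 L)),
        w (plaquetteHolonomy U p 0 1) ∂(Measure.pi fun _ : Edge 2 L => haarProbability G) =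
      (∫ g, w g ∂(haarProbability G)) ^ (R * T) := by
  have h1 : Continuous ((1 : G →* Matrix (Fin 1) (Fin 1) ℂ) : G → Matrix (Fin 1) (Fin 1) ℂ) := by
    have hcoe : ((1 : G →* Matrix (Fin 1) (Fin 1) ℂ) : G → Matrix (Fin 1) (Fin 1) ℂ) = fun _ => 1 :=
      funext fun g => MonoidHom.one_apply g
    rw [hcoe]
    exact continuous_const
  have h := integral_rep_rectangleHolonomy_mul_prod_weight (1 : G →* Matrix (Fin 1) (Fin 1) ℂ) h1 hw hwc
    i j hT hR 0 0
  simp only [MonoidHom.one_apply, Matrix.one_apply_eq, one_mul, pow_apply_fin_one, Matrix.of_apply] at h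
  simp_rw [← Complex.ofReal_prod] at h
  rw [integral_complex_ofReal, integral_complex_ofReal, ← Complex.ofReal_pow] at h
  exact_mod_cast h

/-- **THE FREE-BOUNDARY WILSON-LOOP MATRIX**: normalising the matrix area law by the partition function,
`⟨ρ(W_{R×T})_{ab}⟩_{B,w} := ∫ ρ(W)_{ab} ∏_p w(U_p) / ∫ ∏_p w(U_p) = ((M/∫w)^{RT})_{ab}`,
`M = ∫ ρ(g) w(g) dg` — the `RT`-th power of the normalised one-plaquette matrix `M/∫w`; no perimeter
term, no dependence on `L` (`R + 1 ≤ L`, `T + 1 ≤ L`). -/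
theorem integral_rep_rectangleHolonomy_div_eq {N : ℕ} (ρ : G →* Matrix (Fin N) (Fin N) ℂ)
    (hρ : Continuous ρ) {w : G → ℝ} (hw : Continuous w) (hwc : ∀ k g, w (k * g * k⁻¹) = w g)
    (i j : ZMod L) {R T : ℕ} (hR : R + 1 ≤ L) (hT : T + 1 ≤ L) (a b : Fin N) :
    (∫ U, ρ (rectangleHolonomy U ![i, j] 0 1 R T) a b *
          ∏ p ∈ (range R ×ˢ range T).image (fun q : ℕ × ℕ => (![i + q.1, j + q.2] : Site 2 L)),
            (w (plaquetteHolonomy U p 0 1) : ℂ) ∂(Measure.pi fun _ : Edge 2 L => haarProbability G)) /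
        ((∫ U, ∏ p ∈ (range R ×ˢ range T).image (fun q : ℕ × ℕ => (![i + q.1, j + q.2] : Site 2 L)),
            w (plaquetteHolonomy U p 0 1) ∂(Measure.pi fun _ : Edge 2 L => haarProbability G) : ℝ) : ℂ) =
      ((((∫ g, w g ∂(haarProbability G) : ℝ) : ℂ)⁻¹ •
          (Matrix.of fun k l : Fin N => ∫ g, ρ g k l * (w g : ℂ) ∂(haarProbability G))) ^ (R * T)) a b := by
  rw [integral_rep_rectangleHolonomy_mul_prod_weight ρ hρ hw hwc i j hT hR,
    integral_prod_weight_rect hw hwc i j hR hT, smul_pow, Matrix.smul_apply, smul_eq_mul,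
    Complex.ofReal_pow, div_eq_inv_mul, inv_pow]

/-- **THE EXACT AREA LAW, SCALAR FORM.**  If the one-plaquette matrix is scalar, `M = c·1` (Schur's lemma
for an irreducible `ρ`; for the defining representations of `U(N)`, `SU(N)` see the sequel), then for
the Wilson loop `W = N⁻¹ Re tr ρ(W_{R×T})` of the tree (`wilsonLoop`):
`∫ W · ∏_p w(U_p) dHaar^{⊗E} = Re(c^{RT})`. -/
theorem integral_wilsonLoop_mul_prod_weight_of_scalar {N : ℕ} [NeZero N]
    (ρ : G →* Matrix (Fin N) (Fin N) ℂ) (hρ : Continuous ρ) {w : G → ℝ} (hw : Continuous w)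
    (hwc : ∀ k g, w (k * g * k⁻¹) = w g) {c : ℂ}
    (hM : (Matrix.of fun k l : Fin N => ∫ g, ρ g k l * (w g : ℂ) ∂(haarProbability G)) =
      c • (1 : Matrix (Fin N) (Fin N) ℂ))
    (i j : ZMod L) {R T : ℕ} (hR : R + 1 ≤ L) (hT : T + 1 ≤ L) :
    ∫ U, wilsonLoop ρ ![i, j] 0 1 R T U *
        ∏ p ∈ (range R ×ˢ range T).image (fun q : ℕ × ℕ => (![i + q.1, j + q.2] : Site 2 L)),
          w (plaquetteHolonomy U p 0 1) ∂(Measure.pi fun _ : Edge 2 L => haarProbability G) =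
      (c ^ (R * T)).re := by
  -- the complex observable `tr ρ(W) · ∏ w`
  have hF : ∀ U : GaugeConfig 2 L G,
      wilsonLoop ρ ![i, j] 0 1 R T U *
          ∏ p ∈ (range R ×ˢ range T).image (fun q : ℕ × ℕ => (![i + q.1, j + q.2] : Site 2 L)),
            w (plaquetteHolonomy U p 0 1) =
        (N : ℝ)⁻¹ * (∑ a, ρ (rectangleHolonomy U ![i, j] 0 1 R T) a a *
          ∏ p ∈ (range R ×ˢ range T).image (fun q : ℕ × ℕ => (![i + q.1, j + q.2] : Site 2 L)),
            (w (plaquetteHolonomy U p 0 1) : ℂ)).re := by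
    intro U
    rw [wilsonLoop, mul_assoc]
    congr 1
    rw [← Finset.sum_mul, ← Complex.ofReal_prod, Complex.mul_re, Complex.ofReal_re, Complex.ofReal_im,
      mul_zero, sub_zero]
    rfl
  have hint : ∀ a : Fin N, Integrable (fun U : GaugeConfig 2 L G =>
      ρ (rectangleHolonomy U ![i, j] 0 1 R T) a a *
        ∏ p ∈ (range R ×ˢ range T).image (fun q : ℕ × ℕ => (![i + q.1, j + q.2] : Site 2 L)),
          (w (plaquetteHolonomy U p 0 1) : ℂ))
      (Measure.pi fun _ : Edge 2 L => haarProbability G) := fun a =>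
    integrable_gaugeConfig_of_continuous
      (((hρ.comp (continuous_config_rectangleHolonomy _ 0 1 R T)).matrix_elem a a).mul
        (continuous_finsetProd _ fun p _ =>
          Complex.continuous_ofReal.comp (hw.comp (continuous_config_plaquetteHolonomy p 0 1))))
  have hterm : ∀ a : Fin N,
      ∫ U, ρ (rectangleHolonomy U ![i, j] 0 1 R T) a a *
          ∏ p ∈ (range R ×ˢ range T).image (fun q : ℕ × ℕ => (![i + q.1, j + q.2] : Site 2 L)),
            (w (plaquetteHolonomy U p 0 1) : ℂ) ∂(Measure.pi fun _ : Edge 2 L => haarProbability G) =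
        c ^ (R * T) := by
    intro a
    rw [integral_rep_rectangleHolonomy_mul_prod_weight ρ hρ hw hwc i j hT hR, hM, smul_pow, one_pow,
      Matrix.smul_apply, Matrix.one_apply_eq, smul_eq_mul, mul_one]
  have hre : ∫ U, (∑ a, ρ (rectangleHolonomy U ![i, j] 0 1 R T) a a *
        ∏ p ∈ (range R ×ˢ range T).image (fun q : ℕ × ℕ => (![i + q.1, j + q.2] : Site 2 L)),
          (w (plaquetteHolonomy U p 0 1) : ℂ)).re ∂(Measure.pi fun _ : Edge 2 L => haarProbability G) =
      (∫ U, ∑ a, ρ (rectangleHolonomy U ![i, j] 0 1 R T) a a *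
        ∏ p ∈ (range R ×ˢ range T).image (fun q : ℕ × ℕ => (![i + q.1, j + q.2] : Site 2 L)),
          (w (plaquetteHolonomy U p 0 1) : ℂ) ∂(Measure.pi fun _ : Edge 2 L => haarProbability G)).re := by
    simpa only [RCLike.re_to_complex] using integral_re (integrable_finsetSum _ fun a _ => hint a)
  simp_rw [hF]
  rw [integral_const_mul, hre, integral_finsetSum _ fun a _ => hint a]
  simp only [hterm, Finset.sum_const, Finset.card_univ, Fintype.card_fin, nsmul_eq_mul]
  rw [← Complex.ofReal_natCast, Complex.re_ofReal_mul, ← mul_assoc,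
    inv_mul_cancel₀ (Nat.cast_ne_zero.mpr (NeZero.ne N)), one_mul]

/-- **THE EXACT AREA LAW FOR THE FREE-BOUNDARY WILSON LOOP** (scalar one-plaquette matrix `M = c·1`):
`⟨N⁻¹ Re tr ρ(W_{R×T})⟩_{B,w} = ∫ W ∏_p w(U_p) / ∫ ∏_p w(U_p) = Re((c / ∫ w)^{RT})` — string tension
`−log |c/∫w|`, EXACTLY, with no perimeter or finite-size correction, for every position and size with
`R + 1 ≤ L`, `T + 1 ≤ L`. -/
theorem openWilsonLoop_eq_re_pow_of_scalar {N : ℕ} [NeZero N]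
    (ρ : G →* Matrix (Fin N) (Fin N) ℂ) (hρ : Continuous ρ) {w : G → ℝ} (hw : Continuous w)
    (hwc : ∀ k g, w (k * g * k⁻¹) = w g) {c : ℂ}
    (hM : (Matrix.of fun k l : Fin N => ∫ g, ρ g k l * (w g : ℂ) ∂(haarProbability G)) =
      c • (1 : Matrix (Fin N) (Fin N) ℂ))
    (i j : ZMod L) {R T : ℕ} (hR : R + 1 ≤ L) (hT : T + 1 ≤ L) :
    (∫ U, wilsonLoop ρ ![i, j] 0 1 R T U *
          ∏ p ∈ (range R ×ˢ range T).image (fun q : ℕ × ℕ => (![i + q.1, j + q.2] : Site 2 L)),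
            w (plaquetteHolonomy U p 0 1) ∂(Measure.pi fun _ : Edge 2 L => haarProbability G)) /
        ∫ U, ∏ p ∈ (range R ×ˢ range T).image (fun q : ℕ × ℕ => (![i + q.1, j + q.2] : Site 2 L)),
          w (plaquetteHolonomy U p 0 1) ∂(Measure.pi fun _ : Edge 2 L => haarProbability G) =
      ((c / (∫ g, w g ∂(haarProbability G) : ℝ)) ^ (R * T)).re := by
  rw [integral_wilsonLoop_mul_prod_weight_of_scalar ρ hρ hw hwc hM i j hR hT,
    integral_prod_weight_rect hw hwc i j hR hT, div_pow, ← Complex.ofReal_pow, Complex.div_ofReal_re]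

end Consequences

end AnyGroup

/-! ## §6. `U(N)` and `SU(N)`: the free-boundary Wilson loop is the `RT`-th power of the one-plaquette plaquette -/

section Unitary

/-- The Wilson weight `e^{−β(N − Re tr g)}` on `U(N)` is a class function. -/
theorem unitary_wilsonWeight_conj (N : ℕ) (β : ℝ) (k g : Matrix.unitaryGroup (Fin N) ℂ) :
    Real.exp (-(β * ((N : ℝ) - ((k * g * k⁻¹ : Matrix.unitaryGroup (Fin N) ℂ) :
        Matrix (Fin N) (Fin N) ℂ).trace.re))) =
      Real.exp (-(β * ((N : ℝ) - ((g : Matrix.unitaryGroup (Fin N) ℂ) : Matrix (Fin N) (Fin N) ℂ).trace.re))) := by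
  rw [trace_conj_unitaryGroup]

/-- **THE FREE-BOUNDARY PARTITION FUNCTION OF 2-d `U(N)` LATTICE YANG–MILLS IN CLOSED FORM, EVERY `N`**:
`∫ ∏_{p ∈ B} e^{−β(N − Re tr U_p)} dHaar^{⊗E} = (e^{−Nβ} det[I_{|i−j|}(β)]_{N×N})^{RT}` for the `R × T`
rectangle `B` (`R + 1 ≤ L`, `T + 1 ≤ L`) — GEN-17's one-plaquette Toeplitz determinant to the power area. -/
theorem unitary_open_partitionFunction_eq (N : ℕ) (β : ℝ) (i j : ZMod L) {R T : ℕ} (hR : R + 1 ≤ L)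
    (hT : T + 1 ≤ L) :
    ∫ U, ∏ p ∈ (range R ×ˢ range T).image (fun q : ℕ × ℕ => (![i + q.1, j + q.2] : Site 2 L)),
        Real.exp (-(β * ((N : ℝ) - ((plaquetteHolonomy U p 0 1 : Matrix.unitaryGroup (Fin N) ℂ) :
          Matrix (Fin N) (Fin N) ℂ).trace.re)))
        ∂(Measure.pi fun _ : Edge 2 L => haarProbability (Matrix.unitaryGroup (Fin N) ℂ)) =
      (Real.exp (-(N * β)) *
        (Matrix.of fun a b : Fin N => besselI ((a : ℤ) - (b : ℤ)).natAbs β).det) ^ (R * T) := by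
  have hw : Continuous fun u : Matrix.unitaryGroup (Fin N) ℂ =>
      Real.exp (-(β * ((N : ℝ) - ((u : Matrix.unitaryGroup (Fin N) ℂ) : Matrix (Fin N) (Fin N) ℂ).trace.re))) := by
    fun_prop
  rw [integral_prod_weight_rect hw (unitary_wilsonWeight_conj N β) i j hR hT]
  congr 1
  have hsplit : ∀ u : Matrix.unitaryGroup (Fin N) ℂ,
      Real.exp (-(β * ((N : ℝ) - ((u : Matrix.unitaryGroup (Fin N) ℂ) : Matrix (Fin N) (Fin N) ℂ).trace.re)))
        = Real.exp (-(N * β)) *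
          Real.exp (β * ((u : Matrix.unitaryGroup (Fin N) ℂ) : Matrix (Fin N) (Fin N) ℂ).trace.re) := by
    intro u; rw [← Real.exp_add]; congr 1; ring
  simp_rw [hsplit]
  rw [integral_const_mul, integral_haar_unitaryGroup_fin_exp_mul_trace_re]

/-- **THE EXACT AREA LAW OF TWO-DIMENSIONAL `U(N)` LATTICE YANG–MILLS WITH FREE BOUNDARY, FOR EVERY `N ≥ 1`
AND EVERY REAL `β`.**  For the `R × T` Wilson loop along the boundary of the open `R × T` lattice
(realised in `(ℤ/L)²`, `R + 1 ≤ L`, `T + 1 ≤ L`), in theory-2's conventions (`wilsonLoop = N⁻¹ Re tr W`,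
weight `e^{−β(N − Re tr U_p)}` per plaquette):
`⟨W_{R×T}⟩_{open, β} = P_N(β)^{RT}`, where
`P_N(β) = ∫ (Re tr u / N) e^{−β(N − Re tr u)} du / ∫ e^{−β(N − Re tr u)} du` is the `U(N)` one-plaquette
plaquette — `= N⁻¹ (log det[I_{|i−j|}])'(β)` by row 5 GEN-17's `OnePlaquetteHaarMGF.unitary_plaquette_eq_deriv_log_det`
(`N = 1`: `I₁(β)/I₀(β)`).  No perimeter term, no dependence on the position of the loop or on `L`. -/
theorem unitary_openWilsonLoop_eq_plaquette_pow (N : ℕ) [NeZero N] (β : ℝ) (i j : ZMod L) {R T : ℕ}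
    (hR : R + 1 ≤ L) (hT : T + 1 ≤ L) :
    (∫ U, wilsonLoop (unitaryFundamentalRep (Fin N) ℂ) ![i, j] 0 1 R T U *
          ∏ p ∈ (range R ×ˢ range T).image (fun q : ℕ × ℕ => (![i + q.1, j + q.2] : Site 2 L)),
            Real.exp (-(β * ((N : ℝ) - ((plaquetteHolonomy U p 0 1 : Matrix.unitaryGroup (Fin N) ℂ) :
              Matrix (Fin N) (Fin N) ℂ).trace.re)))
          ∂(Measure.pi fun _ : Edge 2 L => haarProbability (Matrix.unitaryGroup (Fin N) ℂ))) /
        ∫ U, ∏ p ∈ (range R ×ˢ range T).image (fun q : ℕ × ℕ => (![i + q.1, j + q.2] : Site 2 L)),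
            Real.exp (-(β * ((N : ℝ) - ((plaquetteHolonomy U p 0 1 : Matrix.unitaryGroup (Fin N) ℂ) :
              Matrix (Fin N) (Fin N) ℂ).trace.re)))
          ∂(Measure.pi fun _ : Edge 2 L => haarProbability (Matrix.unitaryGroup (Fin N) ℂ)) =
      ((∫ u, ((u : Matrix.unitaryGroup (Fin N) ℂ) : Matrix (Fin N) (Fin N) ℂ).trace.re / N *
            Real.exp (-(β * ((N : ℝ) - ((u : Matrix.unitaryGroup (Fin N) ℂ) : Matrix (Fin N) (Fin N) ℂ).trace.re)))
          ∂(haarProbability (Matrix.unitaryGroup (Fin N) ℂ))) /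
        (∫ u, Real.exp (-(β * ((N : ℝ) - ((u : Matrix.unitaryGroup (Fin N) ℂ) : Matrix (Fin N) (Fin N) ℂ).trace.re)))
          ∂(haarProbability (Matrix.unitaryGroup (Fin N) ℂ)))) ^ (R * T) := by
  have hF : Continuous fun x : ℝ => Real.exp (-(β * ((N : ℝ) - x))) := by fun_prop
  have hw : Continuous fun u : Matrix.unitaryGroup (Fin N) ℂ =>
      Real.exp (-(β * ((N : ℝ) - ((u : Matrix.unitaryGroup (Fin N) ℂ) : Matrix (Fin N) (Fin N) ℂ).trace.re))) := by
    fun_prop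
  have hM : (Matrix.of fun k l : Fin N => ∫ u, (unitaryFundamentalRep (Fin N) ℂ) u k l *
      (Real.exp (-(β * ((N : ℝ) - ((u : Matrix.unitaryGroup (Fin N) ℂ) : Matrix (Fin N) (Fin N) ℂ).trace.re))) : ℂ)
        ∂(haarProbability (Matrix.unitaryGroup (Fin N) ℂ))) =
      (((N : ℝ)⁻¹ * ∫ u, ((u : Matrix.unitaryGroup (Fin N) ℂ) : Matrix (Fin N) (Fin N) ℂ).trace.re *
          Real.exp (-(β * ((N : ℝ) - ((u : Matrix.unitaryGroup (Fin N) ℂ) : Matrix (Fin N) (Fin N) ℂ).trace.re)))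
          ∂(haarProbability (Matrix.unitaryGroup (Fin N) ℂ)) : ℝ) : ℂ) • (1 : Matrix (Fin N) (Fin N) ℂ) := by
    simp only [unitaryFundamentalRep_apply]
    exact unitary_integralMatrix_eq_smul_one N hF
  rw [openWilsonLoop_eq_re_pow_of_scalar (unitaryFundamentalRep (Fin N) ℂ)
    (continuous_unitaryFundamentalRep (Fin N) ℂ) hw (unitary_wilsonWeight_conj N β) hM i j hR hT,
    ← Complex.ofReal_div, ← Complex.ofReal_pow, Complex.ofReal_re, ← integral_const_mul]
  congr 3
  funext u
  ring

end Unitary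

section SpecialUnitary

/-- The Wilson weight `e^{−β(N − Re tr g)}` on `SU(N)` is a class function. -/
theorem specialUnitary_wilsonWeight_conj (N : ℕ) (β : ℝ) (k g : Matrix.specialUnitaryGroup (Fin N) ℂ) :
    Real.exp (-(β * ((N : ℝ) - ((k * g * k⁻¹ : Matrix.specialUnitaryGroup (Fin N) ℂ) :
        Matrix (Fin N) (Fin N) ℂ).trace.re))) =
      Real.exp (-(β * ((N : ℝ) -
        ((g : Matrix.specialUnitaryGroup (Fin N) ℂ) : Matrix (Fin N) (Fin N) ℂ).trace.re))) := by
  rw [trace_conj_specialUnitaryGroup]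

/-- **THE FREE-BOUNDARY PARTITION FUNCTION OF 2-d `SU(N)` LATTICE YANG–MILLS IN CLOSED FORM, EVERY `N ≥ 1`**:
`∫ ∏_{p ∈ B} e^{−β(N − Re tr U_p)} dHaar^{⊗E} = (e^{−Nβ} Σ_{q∈ℤ} det[I_{|q+i−j|}(β)]_{N×N})^{RT}` — GEN-17's
Bars–Green series to the power area. -/
theorem specialUnitary_open_partitionFunction_eq (N : ℕ) [NeZero N] (β : ℝ) (i j : ZMod L) {R T : ℕ}
    (hR : R + 1 ≤ L) (hT : T + 1 ≤ L) :
    ∫ U, ∏ p ∈ (range R ×ˢ range T).image (fun q : ℕ × ℕ => (![i + q.1, j + q.2] : Site 2 L)),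
        Real.exp (-(β * ((N : ℝ) - ((plaquetteHolonomy U p 0 1 : Matrix.specialUnitaryGroup (Fin N) ℂ) :
          Matrix (Fin N) (Fin N) ℂ).trace.re)))
        ∂(Measure.pi fun _ : Edge 2 L => haarProbability (Matrix.specialUnitaryGroup (Fin N) ℂ)) =
      (Real.exp (-(N * β)) *
        ∑' q : ℤ, (Matrix.of fun a b : Fin N => besselI (q + (a : ℤ) - (b : ℤ)).natAbs β).det) ^ (R * T) := by
  have hw : Continuous fun u : Matrix.specialUnitaryGroup (Fin N) ℂ =>
      Real.exp (-(β * ((N : ℝ) -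
        ((u : Matrix.specialUnitaryGroup (Fin N) ℂ) : Matrix (Fin N) (Fin N) ℂ).trace.re))) := by
    fun_prop
  rw [integral_prod_weight_rect hw (specialUnitary_wilsonWeight_conj N β) i j hR hT]
  congr 1
  have hsplit : ∀ u : Matrix.specialUnitaryGroup (Fin N) ℂ,
      Real.exp (-(β * ((N : ℝ) -
          ((u : Matrix.specialUnitaryGroup (Fin N) ℂ) : Matrix (Fin N) (Fin N) ℂ).trace.re)))
        = Real.exp (-(N * β)) *
          Real.exp (β * ((u : Matrix.specialUnitaryGroup (Fin N) ℂ) : Matrix (Fin N) (Fin N) ℂ).trace.re) := by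
    intro u; rw [← Real.exp_add]; congr 1; ring
  simp_rw [hsplit]
  rw [integral_const_mul, integral_haar_specialUnitaryGroup_fin_exp_mul_trace_re]

/-- **THE EXACT AREA LAW OF TWO-DIMENSIONAL `SU(N)` LATTICE YANG–MILLS WITH FREE BOUNDARY, FOR EVERY `N ≥ 1`
AND EVERY REAL `β`.**  `⟨W_{R×T}⟩_{open, β} = P_N(β)^{RT}` with the `SU(N)` one-plaquette plaquette
`P_N(β) = ∫ (Re tr u / N) e^{−β(N − Re tr u)} du / ∫ e^{−β(N − Re tr u)} du` (in Bessel form for every `N`: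
row 5 GEN-17's `SUNOnePlaquetteBesselSeries` / `SUNOnePlaquettePlaquetteBessel`; `N = 2`: `I₂(2β)/I₁(2β)`,
matching GEN-12's character-expansion proof `SU2OpenRectangleWilsonLoops` of the same law; `N = 3`: the
S0-C oracle `OnePlaquetteSU3…`). -/
theorem specialUnitary_openWilsonLoop_eq_plaquette_pow (N : ℕ) [NeZero N] (β : ℝ) (i j : ZMod L)
    {R T : ℕ} (hR : R + 1 ≤ L) (hT : T + 1 ≤ L) :
    (∫ U, wilsonLoop (fundamentalRep (Fin N)) ![i, j] 0 1 R T U *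
          ∏ p ∈ (range R ×ˢ range T).image (fun q : ℕ × ℕ => (![i + q.1, j + q.2] : Site 2 L)),
            Real.exp (-(β * ((N : ℝ) - ((plaquetteHolonomy U p 0 1 : Matrix.specialUnitaryGroup (Fin N) ℂ) :
              Matrix (Fin N) (Fin N) ℂ).trace.re)))
          ∂(Measure.pi fun _ : Edge 2 L => haarProbability (Matrix.specialUnitaryGroup (Fin N) ℂ))) /
        ∫ U, ∏ p ∈ (range R ×ˢ range T).image (fun q : ℕ × ℕ => (![i + q.1, j + q.2] : Site 2 L)),
            Real.exp (-(β * ((N : ℝ) - ((plaquetteHolonomy U p 0 1 : Matrix.specialUnitaryGroup (Fin N) ℂ) :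
              Matrix (Fin N) (Fin N) ℂ).trace.re)))
          ∂(Measure.pi fun _ : Edge 2 L => haarProbability (Matrix.specialUnitaryGroup (Fin N) ℂ)) =
      ((∫ u, ((u : Matrix.specialUnitaryGroup (Fin N) ℂ) : Matrix (Fin N) (Fin N) ℂ).trace.re / N *
            Real.exp (-(β * ((N : ℝ) -
              ((u : Matrix.specialUnitaryGroup (Fin N) ℂ) : Matrix (Fin N) (Fin N) ℂ).trace.re)))
          ∂(haarProbability (Matrix.specialUnitaryGroup (Fin N) ℂ))) /
        (∫ u, Real.exp (-(β * ((N : ℝ) -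
            ((u : Matrix.specialUnitaryGroup (Fin N) ℂ) : Matrix (Fin N) (Fin N) ℂ).trace.re)))
          ∂(haarProbability (Matrix.specialUnitaryGroup (Fin N) ℂ)))) ^ (R * T) := by
  have hF : Continuous fun x : ℝ => Real.exp (-(β * ((N : ℝ) - x))) := by fun_prop
  have hw : Continuous fun u : Matrix.specialUnitaryGroup (Fin N) ℂ =>
      Real.exp (-(β * ((N : ℝ) -
        ((u : Matrix.specialUnitaryGroup (Fin N) ℂ) : Matrix (Fin N) (Fin N) ℂ).trace.re))) := by
    fun_prop
  have hM : (Matrix.of fun k l : Fin N => ∫ u, (fundamentalRep (Fin N)) u k l *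
      (Real.exp (-(β * ((N : ℝ) -
        ((u : Matrix.specialUnitaryGroup (Fin N) ℂ) : Matrix (Fin N) (Fin N) ℂ).trace.re))) : ℂ)
        ∂(haarProbability (Matrix.specialUnitaryGroup (Fin N) ℂ))) =
      (((N : ℝ)⁻¹ * ∫ u, ((u : Matrix.specialUnitaryGroup (Fin N) ℂ) : Matrix (Fin N) (Fin N) ℂ).trace.re *
          Real.exp (-(β * ((N : ℝ) -
            ((u : Matrix.specialUnitaryGroup (Fin N) ℂ) : Matrix (Fin N) (Fin N) ℂ).trace.re)))
          ∂(haarProbability (Matrix.specialUnitaryGroup (Fin N) ℂ)) : ℝ) : ℂ) •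
        (1 : Matrix (Fin N) (Fin N) ℂ) := by
    simp only [fundamentalRep_apply]
    exact specialUnitary_integralMatrix_eq_smul_one N hF
  rw [openWilsonLoop_eq_re_pow_of_scalar (fundamentalRep (Fin N)) (continuous_fundamentalRep (Fin N)) hw
    (specialUnitary_wilsonWeight_conj N β) hM i j hR hT,
    ← Complex.ofReal_div, ← Complex.ofReal_pow, Complex.ofReal_re, ← integral_const_mul]
  congr 3
  funext u
  ring

end SpecialUnitary

end Summit.Ventures.LatticeQCDFlow.Scoring
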